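import Literature.Probability.Percolation.LonelyClusterExchange
import Literature.Probability.Percolation.KozmaNitzanPreFKG
import Literature.Probability.Percolation.PercolationEvents
import Literature.Probability.LatticeModels.ProdBernoulliIndependence
import Literature.Probability.LatticeModels.IsoradialPercolation
import HarnessLib

/-!
# `NoHeavyLowerTail` (stmt-CriticalPhenomena-4575) — the two-relay PREFIX PACKING inequality
# (Kozma–Nitzan's Lemma 2 at an arbitrary level `j`, for a pair of relays)

Bond percolation `μ = prodBernoulli w` on `Fin n`, relays `A`, a vertex `o`, level `j`; for a vertex `v` write
`R_v = {|π(v)| ≤ j}` (`π(v) = {z ∈ A : v ↔ z}`, "the block of `v` is small") and `r_v = μ(R_v)`.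
For two relays `x ≠ y` with `r_y ≤ r_x` (`x` at least as lonely as `y`):

  `μ({o ↔ x} ∩ R_x) · r_y + μ({o ↔ y} ∩ {x ↮ y} ∩ R_y) · r_x ≤ r_x · r_y · μ({o ↔ x} ∪ {o ↔ y})`      (`prefixPacking_two`)

i.e. `P(o ↔ x | R_x) + P(o ↔ y, o ↮ x | R_y) ≤ P(o ↔ {x, y})` — the `|W| = 2` case of the prefix block-credit
inequality PBCR of the crux line (`{o ↔ y} ∩ {x ↮ y} = {o ↔ y} ∩ {o ↮ x}` = "the top relay of `o`'s block in the
order `x, y` is `y`").  At `j = 1` this is Kozma–Nitzan's Lemma 2 for the pair; for `j ≥ 2` the conditioning events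
`R_v` are NOT disconnection events and the two summands do not satisfy the inequality separately (each of the natural
termwise transfers fails); the order hypothesis `r_y ≤ r_x` is necessary.

Proof (prim-gen-swap gen 2): with `D = {x ↮ y}`, `F = {o ↔ x} ∪ {o ↔ y}`, `G_v = R_vᶜ`, the EXACT identity
  `μ(D)·S = μ(D)·r_y·H + r_x·B⁺ − r_y·B⁻ + μ(D ∩ {o↔y})·(r_x − r_y)·μ({x ↔ y} ∩ R_x)`,
where `S` is the slack of the claim, `H = μ(F ∩ G_x) − μ(F)μ(G_x) ≥ 0` (Harris), `B⁺ = μ(D)μ(D∩{o↔y}∩G_y) −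
μ(D∩{o↔y})μ(D∩G_y) ≥ 0` and `B⁻ = μ(D)μ(D∩{o↔y}∩G_x) − μ(D∩{o↔y})μ(D∩G_x) ≤ 0` (van den Berg–Häggström–Kahn 2006,
Thm 1.5, for the clusters of `y` and `x` given `x ↮ y`: `twoClusterExchange`); `μ(D) = 0` is a separate (Harris) case.
-/

noncomputable section

namespace Summit.CriticalPhenomena.PercolationContinuityZ3.Theorems

open MeasureTheory Set
open Literature.Probability.LatticeModels (prodBernoulli prodBernoulli_harris prodBernoulli_harris_upper_lower)
open Literature.Probability.Percolation
open scoped Classical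

variable {n : ℕ}

namespace PrefixPacking

/-- The block-size event `{|π(v)| ≤ j}` is a lower set (decreasing in the configuration). [folklore] -/
theorem isLowerSet_cardLe (A : Finset (Fin n)) (v : Fin n) (j : ℕ) :
    IsLowerSet {ω : BondConfig (Fin n) | (A.filter fun z => ω ∈ openConn v z).card ≤ j} := by
  intro ω ω' hle hω
  simp only [mem_setOf_eq] at hω ⊢
  refine le_trans (Finset.card_le_card fun z hz => ?_) hω
  rw [Finset.mem_filter] at hz ⊢
  exact ⟨hz.1, isUpperSet_openConn v z hle hz.2⟩

/-- `{o ↔ y} ∖ {o ↔ x} = {o ↔ y} ∩ {x ↮ y}`. [folklore] -/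
theorem openConn_inter_compl_eq (o x y : Fin n) :
    (openConn o y : Set (BondConfig (Fin n))) ∩ (openConn o x)ᶜ = openConn o y ∩ (openConn x y)ᶜ := by
  ext ω
  simp only [mem_inter_iff, mem_compl_iff]
  constructor
  · rintro ⟨hoy, hox⟩
    refine ⟨hoy, fun hxy => hox ?_⟩
    exact (hoy : (openGraph ω).Reachable o y).trans (SimpleGraph.Reachable.symm hxy)
  · rintro ⟨hoy, hxy⟩
    refine ⟨hoy, fun hox => hxy ?_⟩
    exact (SimpleGraph.Reachable.symm (hox : (openGraph ω).Reachable o x)).trans hoy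

/-- **Two-relay prefix packing.**  For `x ≠ y` with `μ(R_y) ≤ μ(R_x)`:
`μ({o↔x} ∩ R_x)·μ(R_y) + μ({o↔y} ∩ {x↮y} ∩ R_y)·μ(R_x) ≤ μ(R_x)·μ(R_y)·μ({o↔x} ∪ {o↔y})`.
[cite: KozmaNitzan2024, Lemma 2 (p. 6) — the level-`j` pair version, proved here; VandenbergHaggstromKahn2005, Thm. 1.5] -/
theorem prefixPacking_two (w : Sym2 (Fin n) → unitInterval) (A : Finset (Fin n)) (o x y : Fin n) (j : ℕ)
    (hxy : x ≠ y)
    (h : (prodBernoulli w).real {ω : BondConfig (Fin n) | (A.filter fun z => ω ∈ openConn y z).card ≤ j} ≤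
      (prodBernoulli w).real {ω : BondConfig (Fin n) | (A.filter fun z => ω ∈ openConn x z).card ≤ j}) :
    (prodBernoulli w).real (openConn o x ∩ {ω | (A.filter fun z => ω ∈ openConn x z).card ≤ j}) *
        (prodBernoulli w).real {ω : BondConfig (Fin n) | (A.filter fun z => ω ∈ openConn y z).card ≤ j} +
      (prodBernoulli w).real (openConn o y ∩ (openConn x y)ᶜ ∩
          {ω | (A.filter fun z => ω ∈ openConn y z).card ≤ j}) *
        (prodBernoulli w).real {ω : BondConfig (Fin n) | (A.filter fun z => ω ∈ openConn x z).card ≤ j} ≤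
    (prodBernoulli w).real {ω : BondConfig (Fin n) | (A.filter fun z => ω ∈ openConn x z).card ≤ j} *
      (prodBernoulli w).real {ω : BondConfig (Fin n) | (A.filter fun z => ω ∈ openConn y z).card ≤ j} *
      (prodBernoulli w).real (openConn o x ∪ openConn o y) := by
  set μ := prodBernoulli w with hμ
  set OX : Set (BondConfig (Fin n)) := openConn o x with hOX
  set OY : Set (BondConfig (Fin n)) := openConn o y with hOY
  set Dc : Set (BondConfig (Fin n)) := openConn x y with hDc
  set RX : Set (BondConfig (Fin n)) := {ω | (A.filter fun z => ω ∈ openConn x z).card ≤ j} with hRX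
  set RY : Set (BondConfig (Fin n)) := {ω | (A.filter fun z => ω ∈ openConn y z).card ≤ j} with hRY
  have hmeas : ∀ s : Set (BondConfig (Fin n)), MeasurableSet s := fun _ => MeasurableSet.of_discrete
  -- atomic masses
  set A1 := μ.real (OX ∩ RX) with hA1
  set A2 := μ.real (OX ∩ RXᶜ) with hA2
  set B1 := μ.real (OY ∩ Dcᶜ ∩ RY) with hB1
  set B2 := μ.real (OY ∩ Dcᶜ ∩ RYᶜ) with hB2
  set C1 := μ.real (OY ∩ Dcᶜ ∩ RX) with hC1
  set C2 := μ.real (OY ∩ Dcᶜ ∩ RXᶜ) with hC2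
  set ρx := μ.real (RX ∩ Dcᶜ) with hρx
  set ρy := μ.real (RY ∩ Dcᶜ) with hρy
  set m := μ.real (RX ∩ Dc) with hm
  set d := μ.real Dcᶜ with hd
  -- additive decompositions
  have split : ∀ s t : Set (BondConfig (Fin n)), μ.real s = μ.real (s ∩ t) + μ.real (s ∩ tᶜ) := by
    intro s t
    have := measureReal_inter_add_sdiff (μ := μ) (s := s) (hmeas t)
    rw [Set.sdiff_eq] at this
    linarith
  have f1 : μ.real OX = A1 + A2 := split OX RX
  have f2 : μ.real (OY ∩ Dcᶜ) = B1 + B2 := split _ RY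
  have f3 : μ.real (OY ∩ Dcᶜ) = C1 + C2 := split _ RX
  have f4 : μ.real RX = m + ρx := split RX Dc
  have hmm : μ.real (RY ∩ Dc) = m := by
    rw [hm]
    congr 1
    ext ω
    simp only [mem_inter_iff, hRX, hRY, mem_setOf_eq, hDc]
    constructor
    · rintro ⟨hc, hxy⟩
      refine ⟨le_of_eq_of_le ?_ hc, hxy⟩
      congr 1
      refine Finset.filter_congr fun z _ => ⟨fun hz => ?_, fun hz => ?_⟩
      · exact (SimpleGraph.Reachable.symm (hxy : (openGraph ω).Reachable x y)).trans hz
      · exact (hxy : (openGraph ω).Reachable x y).trans hz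
    · rintro ⟨hc, hxy⟩
      refine ⟨le_of_eq_of_le ?_ hc, hxy⟩
      congr 1
      refine Finset.filter_congr fun z _ => ⟨fun hz => ?_, fun hz => ?_⟩
      · exact (hxy : (openGraph ω).Reachable x y).trans hz
      · exact (SimpleGraph.Reachable.symm (hxy : (openGraph ω).Reachable x y)).trans hz
  have f5 : μ.real RY = m + ρy := by rw [← hmm]; exact split RY Dc
  have huniv : μ.real (univ : Set (BondConfig (Fin n))) = 1 := probReal_univ
  have f7 : μ.real RXᶜ = 1 - μ.real RX := by
    have := split univ RX
    rw [univ_inter, univ_inter, huniv] at this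
    linarith
  have f8 : μ.real (Dcᶜ ∩ RYᶜ) = d - ρy := by
    have := split Dcᶜ RY
    rw [inter_comm Dcᶜ RY] at this
    linarith
  have f9 : μ.real (Dcᶜ ∩ RXᶜ) = d - ρx := by
    have := split Dcᶜ RX
    rw [inter_comm Dcᶜ RX] at this
    linarith
  -- `F = OX ⊔ (OY ∩ D)`
  have hFeq : OX ∪ OY = OX ∪ (OY ∩ Dcᶜ) := by
    rw [← openConn_inter_compl_eq o x y]
    ext ω
    simp only [mem_union, mem_inter_iff, mem_compl_iff]
    tauto
  have hFdisj : Disjoint OX (OY ∩ Dcᶜ) := by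
    rw [← openConn_inter_compl_eq o x y]
    exact Set.disjoint_left.2 fun ω hω hω' => hω'.2 hω
  have f10 : μ.real (OX ∪ OY) = (A1 + A2) + (B1 + B2) := by
    rw [hFeq, measureReal_union hFdisj (hmeas _), f1, f2]
  have f11 : μ.real ((OX ∪ OY) ∩ RXᶜ) = A2 + C2 := by
    rw [hFeq, union_inter_distrib_right,
      measureReal_union (hFdisj.mono inter_subset_left inter_subset_left) (hmeas _)]
  have hDOY : μ.real (Dcᶜ ∩ OY) = B1 + B2 := by rw [inter_comm]; exact f2
  -- (1) Harris: `F` and `G_x = R_xᶜ` are increasing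
  have hFup : IsUpperSet (OX ∪ OY) := (isUpperSet_openConn o x).union (isUpperSet_openConn o y)
  have hGXup : IsUpperSet RXᶜ := (isLowerSet_cardLe A x j).compl
  have hH : μ.real (OX ∪ OY) * μ.real RXᶜ ≤ μ.real ((OX ∪ OY) ∩ RXᶜ) :=
    prodBernoulli_harris w hFup hGXup (hmeas _) (hmeas _)
  rw [f10, f7, f4, f11] at hH
  -- (2) BHK Thm 1.5 for `(s, t) = (x, y)`: `{o ↔ y}` and `G_y` are of type (−), `G_x` of type (+)
  have hOYm : ∀ ⦃ω ω' : BondConfig (Fin n)⦄, openEdgeCluster ω' x ⊆ openEdgeCluster ω x →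
      openEdgeCluster ω y ⊆ openEdgeCluster ω' y → ω ∈ (openConn y o : Set (BondConfig (Fin n))) →
      ω' ∈ (openConn y o : Set (BondConfig (Fin n))) := typeMinus_openConn x y o
  have hGYm : ∀ ⦃ω ω' : BondConfig (Fin n)⦄, openEdgeCluster ω' x ⊆ openEdgeCluster ω x →
      openEdgeCluster ω y ⊆ openEdgeCluster ω' y → ω ∈ RYᶜ → ω' ∈ RYᶜ := by
    intro ω ω' hs ht hω hω'
    exact hω (LonelyClusterExchange.typePlus_card_le A j x y hs ht hω')
  have hGXp : ∀ ⦃ω ω' : BondConfig (Fin n)⦄, openEdgeCluster ω x ⊆ openEdgeCluster ω' x →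
      openEdgeCluster ω' y ⊆ openEdgeCluster ω y → ω ∈ RXᶜ → ω' ∈ RXᶜ := by
    intro ω ω' hs ht hω hω'
    exact hω (LonelyClusterExchange.typeMinus_card_le A j x y hs ht hω')
  have huniv_p : ∀ ⦃ω ω' : BondConfig (Fin n)⦄, openEdgeCluster ω x ⊆ openEdgeCluster ω' x →
      openEdgeCluster ω' y ⊆ openEdgeCluster ω y → ω ∈ (univ : Set (BondConfig (Fin n))) → ω' ∈ (univ : Set _) :=
    fun _ _ _ _ _ => mem_univ _
  have huniv_m : ∀ ⦃ω ω' : BondConfig (Fin n)⦄, openEdgeCluster ω' x ⊆ openEdgeCluster ω x →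
      openEdgeCluster ω y ⊆ openEdgeCluster ω' y → ω ∈ (univ : Set (BondConfig (Fin n))) → ω' ∈ (univ : Set _) :=
    fun _ _ _ _ _ => mem_univ _
  have hOYeq : (openConn y o : Set (BondConfig (Fin n))) = OY := by rw [hOY, KNPreFKG.openConn_symm]
  -- B⁺: `μ(D∩{o↔y}) μ(D∩G_y) ≤ μ(D) μ(D∩{o↔y}∩G_y)`
  have hBp := twoClusterExchange w hxy (A₁ := univ) (A₂ := univ) (B₁ := openConn y o) (B₂ := RYᶜ)
    huniv_p huniv_p hOYm hGYm
  rw [hOYeq] at hBp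
  simp only [univ_inter, inter_univ] at hBp
  -- B⁻: `μ(D) μ(D∩G_x∩{o↔y}) ≤ μ(D∩G_x) μ(D∩{o↔y})`
  have hBm := twoClusterExchange w hxy (A₁ := RXᶜ) (A₂ := univ) (B₁ := openConn y o) (B₂ := univ)
    hGXp huniv_p hOYm huniv_m
  rw [hOYeq] at hBm
  simp only [inter_univ] at hBm
  -- rewrite the BHK inequalities in atomic masses
  have e1 : μ.real (Dcᶜ ∩ (OY ∩ RYᶜ)) = B2 := by rw [hB2, ← inter_assoc, inter_comm Dcᶜ OY]
  have e2 : μ.real (Dcᶜ ∩ (RXᶜ ∩ OY)) = C2 := by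
    rw [hC2, inter_comm RXᶜ OY, ← inter_assoc, inter_comm Dcᶜ OY]
  rw [hDOY, f8, e1] at hBp
  rw [e2, f9, hDOY] at hBm
  -- nonnegativity facts
  have hA1n : 0 ≤ A1 := measureReal_nonneg
  have hA2n : 0 ≤ A2 := measureReal_nonneg
  have hB1n : 0 ≤ B1 := measureReal_nonneg
  have hB2n : 0 ≤ B2 := measureReal_nonneg
  have hC1n : 0 ≤ C1 := measureReal_nonneg
  have hm0 : 0 ≤ m := measureReal_nonneg
  have hρx0 : 0 ≤ ρx := measureReal_nonneg
  have hρy0 : 0 ≤ ρy := measureReal_nonneg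
  have hd0 : 0 ≤ d := measureReal_nonneg
  have hdx : ρx ≤ d := by rw [hρx, hd, inter_comm]; exact measureReal_mono inter_subset_left
  have hdy : ρy ≤ d := by rw [hρy, hd, inter_comm]; exact measureReal_mono inter_subset_left
  have hB1d : B1 ≤ d := by
    rw [hB1, hd]; exact measureReal_mono (fun ω hω => hω.1.2)
  have hrx1 : m + ρx ≤ 1 := by rw [← f4, ← huniv]; exact measureReal_mono (subset_univ _)
  -- the goal in atomic masses
  rw [f4, f5, f10]
  change A1 * (m + ρy) + B1 * (m + ρx) ≤ (m + ρx) * (m + ρy) * ((A1 + A2) + (B1 + B2))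
  have hyp : ρy ≤ ρx := by rw [f4, f5] at h; linarith
  have hC2 : C2 = B1 + B2 - C1 := by linarith
  rw [hC2] at hH hBm
  -- signed pieces
  have tH : 0 ≤ (A2 + (B1 + B2 - C1)) - ((A1 + A2) + (B1 + B2)) * (1 - (m + ρx)) := by linarith
  have tBp : 0 ≤ d * B2 - (B1 + B2) * (d - ρy) := by linarith
  have tBm : 0 ≤ (d - ρx) * (B1 + B2) - d * (B1 + B2 - C1) := by linarith
  have tM : 0 ≤ (B1 + B2) * (ρx - ρy) * m := mul_nonneg (mul_nonneg (by linarith) (by linarith)) hm0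
  -- the identity `d·S = d·r_y·H + r_x·B⁺ + r_y·(−B⁻) + μ(D∩{o↔y})·(r_x−r_y)·m`
  have key : d * ((m + ρx) * (m + ρy) * ((A1 + A2) + (B1 + B2)) - A1 * (m + ρy) - B1 * (m + ρx)) =
      d * (m + ρy) * ((A2 + (B1 + B2 - C1)) - ((A1 + A2) + (B1 + B2)) * (1 - (m + ρx))) +
      (m + ρx) * (d * B2 - (B1 + B2) * (d - ρy)) +
      (m + ρy) * ((d - ρx) * (B1 + B2) - d * (B1 + B2 - C1)) +
      (B1 + B2) * (ρx - ρy) * m := by ring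
  have hS : 0 ≤ d * ((m + ρx) * (m + ρy) * ((A1 + A2) + (B1 + B2)) - A1 * (m + ρy) - B1 * (m + ρx)) := by
    rw [key]
    have t1 : 0 ≤ d * (m + ρy) * ((A2 + (B1 + B2 - C1)) - ((A1 + A2) + (B1 + B2)) * (1 - (m + ρx))) :=
      mul_nonneg (mul_nonneg hd0 (by linarith)) tH
    have t2 : 0 ≤ (m + ρx) * (d * B2 - (B1 + B2) * (d - ρy)) := mul_nonneg (by linarith) tBp
    have t3 : 0 ≤ (m + ρy) * ((d - ρx) * (B1 + B2) - d * (B1 + B2 - C1)) := mul_nonneg (by linarith) tBm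
    linarith
  rcases hd0.eq_or_lt with hdz | hdpos
  · -- `μ(D) = 0`: then `B1 = 0`, and `A1 ≤ μ(OX) μ(R_x)` by Harris (increasing × decreasing)
    have hB10 : B1 = 0 := le_antisymm (hdz ▸ hB1d) hB1n
    have hHL : A1 ≤ (A1 + A2) * (m + ρx) := by
      rw [← f1, ← f4, hA1]
      exact prodBernoulli_harris_upper_lower w (isUpperSet_openConn o x) (isLowerSet_cardLe A x j)
        (hmeas _) (hmeas _)
    rw [hB10]
    have hrx0 : (0:ℝ) ≤ m + ρx := by linarith
    have hry0 : (0:ℝ) ≤ m + ρy := by linarith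
    have h1 := mul_le_mul_of_nonneg_right hHL hry0
    have h2 : 0 ≤ (m + ρx) * (m + ρy) * B2 := mul_nonneg (mul_nonneg hrx0 hry0) hB2n
    have h3 : (m + ρx) * (m + ρy) * ((A1 + A2) + (0 + B2)) =
        (A1 + A2) * (m + ρx) * (m + ρy) + (m + ρx) * (m + ρy) * B2 := by ring
    have h4 : A1 * (m + ρy) + 0 * (m + ρx) = A1 * (m + ρy) := by ring
    rw [h3, h4]
    linarith
  · have := le_of_mul_le_mul_left (by linarith [hS] : d * 0 ≤ d * ((m + ρx) * (m + ρy) *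
        ((A1 + A2) + (B1 + B2)) - A1 * (m + ρy) - B1 * (m + ρx))) hdpos
    linarith

end PrefixPacking

/-- **Two-relay prefix packing, conditional-probability form.**  For `x ≠ y` with `μ(R_y) ≤ μ(R_x)`, in the
notation of `PrefixPacking.prefixPacking_two`, with `{o↔y} ∩ {o↮x}` in place of `{o↔y} ∩ {x↮y}` (the same event):
`μ({o↔x} ∩ R_x)·μ(R_y) + μ({o↔y} ∩ {o↮x} ∩ R_y)·μ(R_x) ≤ μ(R_x)·μ(R_y)·μ({o↔x} ∪ {o↔y})`.
[cite: KozmaNitzan2024, Lemma 2 (p. 6) — level-`j` pair version, proved in this file] -/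
theorem prefixPacking_two (w : Sym2 (Fin n) → unitInterval) (A : Finset (Fin n)) (o x y : Fin n) (j : ℕ)
    (hxy : x ≠ y)
    (h : (prodBernoulli w).real {ω : BondConfig (Fin n) | (A.filter fun z => ω ∈ openConn y z).card ≤ j} ≤
      (prodBernoulli w).real {ω : BondConfig (Fin n) | (A.filter fun z => ω ∈ openConn x z).card ≤ j}) :
    (prodBernoulli w).real (openConn o x ∩ {ω | (A.filter fun z => ω ∈ openConn x z).card ≤ j}) *
        (prodBernoulli w).real {ω : BondConfig (Fin n) | (A.filter fun z => ω ∈ openConn y z).card ≤ j} +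
      (prodBernoulli w).real (openConn o y ∩ (openConn o x)ᶜ ∩
          {ω | (A.filter fun z => ω ∈ openConn y z).card ≤ j}) *
        (prodBernoulli w).real {ω : BondConfig (Fin n) | (A.filter fun z => ω ∈ openConn x z).card ≤ j} ≤
    (prodBernoulli w).real {ω : BondConfig (Fin n) | (A.filter fun z => ω ∈ openConn x z).card ≤ j} *
      (prodBernoulli w).real {ω : BondConfig (Fin n) | (A.filter fun z => ω ∈ openConn y z).card ≤ j} *
      (prodBernoulli w).real (openConn o x ∪ openConn o y) := by
  rw [PrefixPacking.openConn_inter_compl_eq o x y]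
  exact PrefixPacking.prefixPacking_two w A o x y j hxy h

end Summit.CriticalPhenomena.PercolationContinuityZ3.Theorems

end
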